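import Summits.AnomalousDissipation.AnomalousDissipation.Theorems.TaylorCertificatePair.Negative.Ceiling
import Literature.Analysis.FunctionSpaces.TorusSobolevSpaceProofs
import Literature.Analysis.FluidPDE.SteadyNavierStokesEnergy

/-!
# Negative knowledge for the crux `EnsembleCeiling` (stmt-AnomalousDissipation-14090), IV:
# single-shell Euler-steady forces are fat (the Beltrami / ABC class)

Crux `TaylorCertificates.EnsembleCeiling` (route `AnomalousDissipation/TaylorCertificates`, rank 4),
cdisprove seat `refuter-cdisprove-stmt-AnomalousDissipation-14090-0`. Parts I–II killed the conclusion of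
the crux for single modes and for the orthogonal class. This part isolates the mechanism: for a real
trigonometric-polynomial force `f = ∑ₘ Re(e_{kₘ} zₘ)` carried by ONE Stokes shell `|kₘ|² = s` whose
inertial term vanishes weakly (`∫ (f ⊗ f) : ∇w = 0` for every test field `w` — `f` is a steady Euler
flow), the laminar state `u_ν = f/(4π²sν)` is an exact steady state of `NS_ν(f)` for every `ν`, its
Dirac mass a stationary statistical solution (tree theorem `Torus.isStationaryStatisticalSolution_dirac_holds`)
of energy `‖f‖₂²/(16π⁴s²ν²)` — so `f` has no ensemble ceiling. The hypothesis is then discharged for the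
ABC (Arnold–Beltrami–Childress) forces `(A sin 2πx₃ + C cos 2πx₂, B sin 2πx₁ + A cos 2πx₃,
C sin 2πx₂ + B cos 2πx₁)`, the pure-helical first-shell fields (`curl f = 2πf`, `(f·∇)f = ∇|f|²/2`):
by the pair formula the inertial term against a divergence-free `w` collects, frequency by frequency,
into multiples of `κ · ŵ(κ) = 0`.

* `exists_fat_stationary_of_singleShell_eulerSteady`, `not_ceiling_of_singleShell_eulerSteady`;
* `abc_inertial_eq_zero` (the ABC fields are weakly Euler-steady), `not_ceiling_abc`.
Nothing here asserts a Theses statement.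
-/

noncomputable section

open MeasureTheory UnitAddTorus Matrix
open scoped InnerProductSpace ENNReal ComplexConjugate

namespace Summit.AnomalousDissipation.AnomalousDissipation.Theorems.EnsembleCeiling.Negative

open Literature.Analysis.FunctionSpaces Literature.Analysis.FluidPDE
open Summit.AnomalousDissipation.AnomalousDissipation.Theorems.TaylorCertificatePair.Negative

/-! ### Scalar multiples under the three pairings -/

/-- `∫ ⟪c v, w⟫ = c ∫ ⟪v, w⟫`. -/
theorem integral_inner_const_smul_left (c : ℝ) (v w : (UnitAddTorus (Fin 3)) → (EuclideanSpace ℝ (Fin 3))) :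
    ∫ x, ⟪c • v x, w x⟫_ℝ = c * ∫ x, ⟪v x, w x⟫_ℝ := by
  rw [← integral_const_mul]
  exact integral_congr_ae (ae_of_all _ fun x => real_inner_smul_left _ _ _)

/-- `∫ ‖c v‖² = c² ∫ ‖v‖²`. -/
theorem integral_norm_sq_const_smul (c : ℝ) (v : (UnitAddTorus (Fin 3)) → (EuclideanSpace ℝ (Fin 3))) :
    ∫ x, ‖c • v x‖ ^ 2 = c ^ 2 * ∫ x, ‖v x‖ ^ 2 := by
  rw [← integral_const_mul]
  refine integral_congr_ae (ae_of_all _ fun x => ?_)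
  simp only [norm_smul, mul_pow, Real.norm_eq_abs, sq_abs]

/-- The inertial integrand is quadratic: `∫ ⟪DW[c v], c v⟫ = c² ∫ ⟪DW[v], v⟫`. -/
theorem integral_inertial_const_smul (c : ℝ) (v W : (UnitAddTorus (Fin 3)) → (EuclideanSpace ℝ (Fin 3))) :
    ∫ x, ⟪Torus.fderiv W x (c • v x), c • v x⟫_ℝ = c ^ 2 * ∫ x, ⟪Torus.fderiv W x (v x), v x⟫_ℝ := by
  rw [← integral_const_mul]
  refine integral_congr_ae (ae_of_all _ fun x => ?_)
  simp only [map_smul, real_inner_smul_left, real_inner_smul_right]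
  ring

section SingleShell

variable {n : ℕ} {k : Fin n → (Fin 3 → ℤ)} {z : Fin n → (EuclideanSpace ℂ (Fin 3))}

/-- On a single Stokes shell the Laplacian pairing is `-4π²s` times the `L²` pairing:
`∫ ⟪f, Δw⟫ = -4π²s ∫ ⟪f, w⟫` for `f = ∑ₘ Re(e_{kₘ} zₘ)`, `|kₘ|² = s`. -/
theorem integral_inner_modes_laplacian_singleShell {s : ℝ} (hs : ∀ m, Torus.freqNormSq (k m) = s)
    {w : (UnitAddTorus (Fin 3)) → (EuclideanSpace ℝ (Fin 3))} (hw : Torus.IsSmooth w) :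
    ∫ x, ⟪(∑ mm, Torus.realTrigPoly {k mm} (fun _ => z mm)) x, Torus.laplacian w x⟫_ℝ =
      -(4 * Real.pi ^ 2 * s) * ∫ x, ⟪(∑ mm, Torus.realTrigPoly {k mm} (fun _ => z mm)) x, w x⟫_ℝ := by
  rw [integral_inner_modes_laplacian hw, integral_inner_modes_left hw.integrable, Finset.mul_sum]
  refine Finset.sum_congr rfl fun m _ => ?_
  rw [hs m, inner_neg_right, inner_smul_right, Complex.neg_re, Complex.re_ofReal_mul]
  ring

/-- **Single-shell Euler-steady forces carry the laminar Dirac stationary statistical solution.**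
`f = ∑ₘ Re(e_{kₘ} zₘ)` transversal, on one shell `|kₘ|² = s > 0`, weakly Euler-steady
(`∫ (f ⊗ f) : ∇w = 0` for all test fields): for every `ν > 0` the Dirac mass at `f/(4π²sν)` is a
stationary statistical solution of `NS_ν(f)` with mean energy `‖f‖₂²/(16π⁴s²ν²)`. -/
theorem exists_fat_stationary_of_singleShell_eulerSteady {s : ℝ} (hs : ∀ m, Torus.freqNormSq (k m) = s)
    (hs0 : 0 < s) (hz : ∀ m, ((fun j => (((k m)) j : ℂ)) ⬝ᵥ (WithLp.ofLp ((z m)))) = 0)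
    (hI : ∀ w : (UnitAddTorus (Fin 3)) → (EuclideanSpace ℝ (Fin 3)), Torus.IsSmooth w → Torus.IsDivFree w →
      Torus.HasZeroMean w →
        ∫ x, ⟪Torus.fderiv w x ((∑ mm, Torus.realTrigPoly {k mm} (fun _ => z mm)) x),
          (∑ mm, Torus.realTrigPoly {k mm} (fun _ => z mm)) x⟫_ℝ = 0)
    {ν : ℝ} (hν : 0 < ν) :
    ∃ μ : Measure (Torus.energySpace (Fin 3)),
      Torus.IsStationaryStatisticalSolution ν (∑ mm, Torus.realTrigPoly {k mm} (fun _ => z mm)) μ ∧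
      Integrable (fun v : (Torus.energySpace (Fin 3)) => ‖v‖ ^ 2) μ ∧
      Torus.ensembleEnergy μ =
        (∫ x, ‖(∑ mm, Torus.realTrigPoly {k mm} (fun _ => z mm)) x‖ ^ 2) / (16 * Real.pi ^ 4 * s ^ 2 * ν ^ 2) := by
  have hk : ∀ m, k m ≠ 0 := fun m h0 => by
    have := hs m
    rw [h0, Torus.freqNormSq_zero] at this
    exact hs0.ne this
  set c : ℝ := (4 * Real.pi ^ 2 * s * ν)⁻¹ with hc
  have hcν : ν * c * (4 * Real.pi ^ 2 * s) = 1 := by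
    rw [hc]
    field_simp
  have hfs : Torus.IsSmooth (∑ mm, Torus.realTrigPoly {k mm} (fun _ => z mm)) := isSmooth_modes k z
  have hfd : Torus.IsDivFree (∑ mm, Torus.realTrigPoly {k mm} (fun _ => z mm)) := isDivFree_modes k z hz
  have hfz : Torus.HasZeroMean (∑ mm, Torus.realTrigPoly {k mm} (fun _ => z mm)) := hasZeroMean_modes k z hk
  set uf : (UnitAddTorus (Fin 3)) → (EuclideanSpace ℝ (Fin 3)) := fun x => c • (∑ mm, Torus.realTrigPoly {k mm} (fun _ => z mm)) x with huf
  have huf' : uf = fun y => ∑ i ∈ ({0} : Finset ℕ), (fun _ : ℕ => c) i • (fun _ : ℕ => (∑ mm, Torus.realTrigPoly {k mm} (fun _ => z mm))) i y := by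
    funext y
    simp [huf]
  have hsm : Torus.IsSmooth uf := hfs.smul c
  have hdf : Torus.IsDivFree uf := by
    rw [huf']
    exact Torus.IsDivFree.sum_smul _ _ (fun _ => hfs) (fun _ => hfd)
  have hzm : Torus.HasZeroMean uf := by
    rw [huf']
    exact Torus.HasZeroMean.sum_smul _ _ (fun _ => hfs.integrable) (fun _ => hfz)
  have hmem : MemLp uf 2 volume := hsm.memLp 2
  obtain ⟨u, hu⟩ : ∃ u : (Torus.energySpace (Fin 3)), (((u : (Torus.energySpace (Fin 3))) : (Lp (EuclideanSpace ℝ (Fin 3)) 2 (volume : Measure (UnitAddTorus (Fin 3))))) : ((UnitAddTorus (Fin 3)) → (EuclideanSpace ℝ (Fin 3)))) =ᵐ[volume] uf :=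
    ⟨⟨hmem.toLp uf, Torus.smoothSolenoidal_subset_energySpace ⟨uf, hsm, hdf, hzm, hmem.coeFn_toLp⟩⟩,
      hmem.coeFn_toLp⟩
  have hV : ((u : (Torus.energySpace (Fin 3))) : (Lp (EuclideanSpace ℝ (Fin 3)) 2 (volume : Measure (UnitAddTorus (Fin 3))))) ∈ Torus.energySpaceV (Fin 3) :=
    Torus.smoothSolenoidal_subset_energySpaceV_holds ⟨uf, hsm, hdf, hzm, hu⟩
  have hsteady : Torus.IsSteadyWeakSolution ν (∑ mm, Torus.realTrigPoly {k mm} (fun _ => z mm)) u := by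
    intro w hw hdw hzw
    rw [nsGeneratorPairing_of_ae hu, huf, integral_inertial_const_smul, hI w hw hdw hzw, mul_zero, add_zero,
      integral_inner_const_smul_left, integral_inner_modes_laplacian_singleShell hs hw]
    have : (∫ x, ⟪(∑ mm, Torus.realTrigPoly {k mm} (fun _ => z mm)) x, w x⟫_ℝ) +
        ν * (c * (-(4 * Real.pi ^ 2 * s) * ∫ x, ⟪(∑ mm, Torus.realTrigPoly {k mm} (fun _ => z mm)) x, w x⟫_ℝ)) =
        (1 - ν * c * (4 * Real.pi ^ 2 * s)) * ∫ x, ⟪(∑ mm, Torus.realTrigPoly {k mm} (fun _ => z mm)) x, w x⟫_ℝ := by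
      ring
    rw [this, hcν, sub_self, zero_mul]
  haveI : MeasurableSingletonClass (Torus.energySpace (Fin 3)) := OpensMeasurableSpace.toMeasurableSingletonClass
  refine ⟨Measure.dirac u, Torus.isStationaryStatisticalSolution_dirac_holds hν.le (memLp_modes k z) (by simp) hV hsteady,
    Torus.integrable_dirac u _, ?_⟩
  unfold Torus.ensembleEnergy
  rw [integral_dirac, norm_sq_of_ae hu, huf, integral_norm_sq_const_smul, hc]
  have hs0' : s ≠ 0 := hs0.ne'
  field_simp
  ring

/-- **No ensemble ceiling for a single-shell Euler-steady force** (`f ≠ 0`): at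
`ν = min(ν₀/2, 1, A/(|E|+1))`, `A = ‖f‖₂²/(16π⁴s²)`, the laminar Dirac mass has mean energy
`A/ν² > E`. -/
theorem not_ceiling_of_singleShell_eulerSteady {s : ℝ} (hs : ∀ m, Torus.freqNormSq (k m) = s)
    (hs0 : 0 < s) (hz : ∀ m, ((fun j => (((k m)) j : ℂ)) ⬝ᵥ (WithLp.ofLp ((z m)))) = 0)
    (hI : ∀ w : (UnitAddTorus (Fin 3)) → (EuclideanSpace ℝ (Fin 3)), Torus.IsSmooth w → Torus.IsDivFree w →
      Torus.HasZeroMean w →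
        ∫ x, ⟪Torus.fderiv w x ((∑ mm, Torus.realTrigPoly {k mm} (fun _ => z mm)) x),
          (∑ mm, Torus.realTrigPoly {k mm} (fun _ => z mm)) x⟫_ℝ = 0)
    (hf0 : 0 < ∫ x, ‖(∑ mm, Torus.realTrigPoly {k mm} (fun _ => z mm)) x‖ ^ 2) :
    ¬ ∃ (E ν₀ : ℝ), 0 < ν₀ ∧ ∀ ν : ℝ, 0 < ν → ν < ν₀ → ∀ μ : Measure (Torus.energySpace (Fin 3)),
      Torus.IsStationaryStatisticalSolution ν (∑ mm, Torus.realTrigPoly {k mm} (fun _ => z mm)) μ →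
        Integrable (fun v : (Torus.energySpace (Fin 3)) => ‖v‖ ^ 2) μ → Torus.ensembleEnergy μ ≤ E := by
  rintro ⟨E, ν₀, hν₀, h⟩
  set A : ℝ := (∫ x, ‖(∑ mm, Torus.realTrigPoly {k mm} (fun _ => z mm)) x‖ ^ 2) / (16 * Real.pi ^ 4 * s ^ 2) with hA
  have hApos : 0 < A := by positivity
  have hE1 : 0 < |E| + 1 := by positivity
  set ν : ℝ := min (ν₀ / 2) (min 1 (A / (|E| + 1))) with hνdef
  have hν : 0 < ν := lt_min (half_pos hν₀) (lt_min one_pos (div_pos hApos hE1))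
  have hνν₀ : ν < ν₀ := (min_le_left _ _).trans_lt (half_lt_self hν₀)
  have hν1 : ν ≤ 1 := (min_le_right _ _).trans (min_le_left _ _)
  have hνA : ν ≤ A / (|E| + 1) := (min_le_right _ _).trans (min_le_right _ _)
  obtain ⟨μ, hμ, hint, hen⟩ := exists_fat_stationary_of_singleShell_eulerSteady hs hs0 hz hI hν
  have hle := h ν hν hνν₀ μ hμ hint
  have hAν : (∫ x, ‖(∑ mm, Torus.realTrigPoly {k mm} (fun _ => z mm)) x‖ ^ 2) / (16 * Real.pi ^ 4 * s ^ 2 * ν ^ 2) =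
      A / ν ^ 2 := by
    rw [hA, div_div]
  rw [hen, hAν, div_le_iff₀ (by positivity)] at hle
  have h1 : E * ν ^ 2 ≤ |E| * ν := by
    calc E * ν ^ 2 ≤ |E| * ν ^ 2 := mul_le_mul_of_nonneg_right (le_abs_self E) (sq_nonneg ν)
      _ ≤ |E| * ν := mul_le_mul_of_nonneg_left (by nlinarith) (abs_nonneg E)
  have h2 : |E| * ν ≤ |E| * (A / (|E| + 1)) := mul_le_mul_of_nonneg_left hνA (abs_nonneg E)
  have h3 : |E| * (A / (|E| + 1)) < A := by
    rw [mul_div_assoc', div_lt_iff₀ hE1]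
    nlinarith
  linarith

/-! ### Energy of a mode sum in normal form -/

/-- Parseval for a mode sum with frequencies in normal form (nonzero, pairwise distinct and
non-opposite): `∫ ‖∑ₘ Re(e_{kₘ} zₘ)‖² = ∑ₘ ½‖zₘ‖²`. -/
theorem integral_norm_sq_modes_of_normalForm (hk : ∀ m, k m ≠ 0)
    (hres : ∀ m m', m ≠ m' → k m ≠ k m' ∧ k m ≠ -k m') :
    ∫ x, ‖(∑ mm, Torus.realTrigPoly {k mm} (fun _ => z mm)) x‖ ^ 2 = ∑ m, 2⁻¹ * ‖z m‖ ^ 2 := by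
  have hfc : ∀ m, mFourierCoeff (EuclideanSpace.complexify ∘ (∑ mm, Torus.realTrigPoly {k mm} (fun _ => z mm))) (k m) =
      (2 : ℂ)⁻¹ • z m := by
    intro m
    rw [fc_modes, Finset.sum_eq_single m]
    · have hne : k m ≠ -k m := by
        intro h
        apply hk m
        funext i
        have hi := congrFun h i
        simp only [Pi.neg_apply] at hi
        simp only [Pi.zero_apply]
        omega
      rw [fc_mode, if_pos rfl, if_neg hne, EuclideanSpace.conjVec_zero, add_zero]
    · intro m' _ hm'
      obtain ⟨h1, h2⟩ := hres m m' (Ne.symm hm')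
      rw [fc_mode, if_neg h1, if_neg h2, EuclideanSpace.conjVec_zero, add_zero, smul_zero]
    · intro h
      exact absurd (Finset.mem_univ m) h
  have h1 : ∫ x, ‖(∑ mm, Torus.realTrigPoly {k mm} (fun _ => z mm)) x‖ ^ 2 =
      ∫ x, ⟪(∑ mm, Torus.realTrigPoly {k mm} (fun _ => z mm)) x, (∑ mm, Torus.realTrigPoly {k mm} (fun _ => z mm)) x⟫_ℝ :=
    integral_congr_ae (ae_of_all _ fun x => (real_inner_self_eq_norm_sq _).symm)
  rw [h1, integral_inner_modes_left (isSmooth_modes k z).integrable]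
  refine Finset.sum_congr rfl fun m _ => ?_
  rw [hfc m, inner_smul_right, show (2 : ℂ)⁻¹ = ((2⁻¹ : ℝ) : ℂ) by norm_num, Complex.re_ofReal_mul]
  have hzz : (⟪z m, z m⟫_ℂ).re = ‖z m‖ ^ 2 := by
    have := inner_self_eq_norm_sq (𝕜 := ℂ) (z m)
    simpa using this
  rw [hzz]

end SingleShell

/-! ### The ABC forces -/

/-- **The ABC fields are weakly Euler-steady.** For the Arnold–Beltrami–Childress field
`f = (A sin 2πx₃ + C cos 2πx₂, B sin 2πx₁ + A cos 2πx₃, C sin 2πx₂ + B cos 2πx₁)`, written as the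
first-shell mode sum with frequencies `e₃, e₁, e₂` and helical amplitudes `A(-i,1,0)`, `B(0,-i,1)`,
`C(1,0,-i)`, the inertial term `∫ (f ⊗ f) : ∇w` vanishes against every smooth divergence-free `w`:
by the pair formula it is a sum over the interaction frequencies `eᵢ ± eⱼ`, and at each of them the
two helical contributions add up to a multiple of `κ · ŵ(κ) = 0` (reality `ŵ(-κ) = conj ŵ(κ)` pairs
`±κ`). This is the Fourier face of `(f·∇)f = ∇|f|²/2` for Beltrami fields (`curl f = 2πf`). -/
theorem abc_inertial_eq_zero (A B C : ℝ) {w : (UnitAddTorus (Fin 3)) → (EuclideanSpace ℝ (Fin 3))}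
    (hw : Torus.IsSmooth w) (hdw : Torus.IsDivFree w) :
    ∫ x, ⟪Torus.fderiv w x ((∑ mm, Torus.realTrigPoly {(![![0, 0, 1], ![1, 0, 0], ![0, 1, 0]] : Fin 3 → (Fin 3 → ℤ)) mm}
        (fun _ => (![(A : ℂ) • (WithLp.toLp 2 ![-Complex.I, 1, 0] : EuclideanSpace ℂ (Fin 3)),
                    (B : ℂ) • (WithLp.toLp 2 ![0, -Complex.I, 1] : EuclideanSpace ℂ (Fin 3)),
                    (C : ℂ) • (WithLp.toLp 2 ![1, 0, -Complex.I] : EuclideanSpace ℂ (Fin 3))] : Fin 3 → EuclideanSpace ℂ (Fin 3)) mm)) x),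
        (∑ mm, Torus.realTrigPoly {(![![0, 0, 1], ![1, 0, 0], ![0, 1, 0]] : Fin 3 → (Fin 3 → ℤ)) mm}
        (fun _ => (![(A : ℂ) • (WithLp.toLp 2 ![-Complex.I, 1, 0] : EuclideanSpace ℂ (Fin 3)),
                    (B : ℂ) • (WithLp.toLp 2 ![0, -Complex.I, 1] : EuclideanSpace ℂ (Fin 3)),
                    (C : ℂ) • (WithLp.toLp 2 ![1, 0, -Complex.I] : EuclideanSpace ℂ (Fin 3))] : Fin 3 → EuclideanSpace ℂ (Fin 3)) mm)) x⟫_ℝ = 0 := by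
  rw [inertial_modes hw]
  simp only [Fin.sum_univ_three, Matrix.cons_val_zero, Matrix.cons_val_one, Matrix.cons_val_two,
    Matrix.head_cons, Matrix.tail_cons]
  -- frequency arithmetic
  have a33 : ((![0, 0, 1] : Fin 3 → ℤ) + ![0, 0, 1]) = ![0, 0, 2] := by decide
  have a31 : ((![0, 0, 1] : Fin 3 → ℤ) + ![1, 0, 0]) = ![1, 0, 1] := by decide
  have a32 : ((![0, 0, 1] : Fin 3 → ℤ) + ![0, 1, 0]) = ![0, 1, 1] := by decide
  have a13 : ((![1, 0, 0] : Fin 3 → ℤ) + ![0, 0, 1]) = ![1, 0, 1] := by decide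
  have a11 : ((![1, 0, 0] : Fin 3 → ℤ) + ![1, 0, 0]) = ![2, 0, 0] := by decide
  have a12 : ((![1, 0, 0] : Fin 3 → ℤ) + ![0, 1, 0]) = ![1, 1, 0] := by decide
  have a23 : ((![0, 1, 0] : Fin 3 → ℤ) + ![0, 0, 1]) = ![0, 1, 1] := by decide
  have a21 : ((![0, 1, 0] : Fin 3 → ℤ) + ![1, 0, 0]) = ![1, 1, 0] := by decide
  have a22 : ((![0, 1, 0] : Fin 3 → ℤ) + ![0, 1, 0]) = ![0, 2, 0] := by decide
  have d33 : ((![0, 0, 1] : Fin 3 → ℤ) - ![0, 0, 1]) = 0 := by decide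
  have d13 : ((![1, 0, 0] : Fin 3 → ℤ) - ![0, 0, 1]) = ![1, 0, -1] := by decide
  have d23 : ((![0, 1, 0] : Fin 3 → ℤ) - ![0, 0, 1]) = ![0, 1, -1] := by decide
  have d31 : ((![0, 0, 1] : Fin 3 → ℤ) - ![1, 0, 0]) = -![1, 0, -1] := by decide
  have d11 : ((![1, 0, 0] : Fin 3 → ℤ) - ![1, 0, 0]) = 0 := by decide
  have d21 : ((![0, 1, 0] : Fin 3 → ℤ) - ![1, 0, 0]) = -![1, -1, 0] := by decide
  have d32 : ((![0, 0, 1] : Fin 3 → ℤ) - ![0, 1, 0]) = -![0, 1, -1] := by decide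
  have d12 : ((![1, 0, 0] : Fin 3 → ℤ) - ![0, 1, 0]) = ![1, -1, 0] := by decide
  have d22 : ((![0, 1, 0] : Fin 3 → ℤ) - ![0, 1, 0]) = 0 := by decide
  have hcs : ∀ κ : Fin 3 → ℤ, mFourierCoeff (EuclideanSpace.complexify ∘ w) (-κ) =
      EuclideanSpace.conjVec (mFourierCoeff (EuclideanSpace.complexify ∘ w) κ) :=
    Torus.isConjSymm_mFourierCoeff hw.integrable
  simp only [a33, a31, a32, a13, a11, a12, a23, a21, a22, d33, d13, d23, d31, d11, d21, d32, d12, d22, hcs]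
  simp only [dotProduct, Fin.sum_univ_three, WithLp.ofLp_smul, Pi.smul_apply, Pi.neg_apply,
    Pi.zero_apply, smul_eq_mul, Matrix.cons_val_zero, Matrix.cons_val_one, Matrix.cons_val_two, Matrix.head_cons,
    Matrix.tail_cons, inner_smul_right, PiLp.inner_apply, RCLike.inner_apply, EuclideanSpace.conjVec_apply,
    Complex.conj_conj, neg_zero, neg_neg, Int.cast_zero, Int.cast_one, Int.cast_neg, Int.cast_ofNat,
    zero_mul, mul_zero, one_mul, mul_one, zero_add, add_zero]
  -- the six divergence relations `κ · ŵ(κ) = 0`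
  have r101 := hdw.sum_mul_mFourierCoeff_eq_zero hw ![1, 0, 1]
  have r011 := hdw.sum_mul_mFourierCoeff_eq_zero hw ![0, 1, 1]
  have r110 := hdw.sum_mul_mFourierCoeff_eq_zero hw ![1, 1, 0]
  have r10m := hdw.sum_mul_mFourierCoeff_eq_zero hw ![1, 0, -1]
  have r01m := hdw.sum_mul_mFourierCoeff_eq_zero hw ![0, 1, -1]
  have r1m0 := hdw.sum_mul_mFourierCoeff_eq_zero hw ![1, -1, 0]
  simp only [Fin.sum_univ_three, Matrix.cons_val_zero, Matrix.cons_val_one, Matrix.cons_val_two,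
    Matrix.head_cons, Matrix.tail_cons, Int.cast_zero, Int.cast_one, Int.cast_neg, zero_mul, one_mul, neg_mul,
    zero_add, add_zero] at r101 r011 r110 r10m r01m r1m0
  have s101 : (mFourierCoeff (EuclideanSpace.complexify ∘ w) ![1, 0, 1]).ofLp 2 =
      -(mFourierCoeff (EuclideanSpace.complexify ∘ w) ![1, 0, 1]).ofLp 0 := by linear_combination r101
  have s011 : (mFourierCoeff (EuclideanSpace.complexify ∘ w) ![0, 1, 1]).ofLp 2 =
      -(mFourierCoeff (EuclideanSpace.complexify ∘ w) ![0, 1, 1]).ofLp 1 := by linear_combination r011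
  have s110 : (mFourierCoeff (EuclideanSpace.complexify ∘ w) ![1, 1, 0]).ofLp 1 =
      -(mFourierCoeff (EuclideanSpace.complexify ∘ w) ![1, 1, 0]).ofLp 0 := by linear_combination r110
  have s10m : (mFourierCoeff (EuclideanSpace.complexify ∘ w) ![1, 0, -1]).ofLp 2 =
      (mFourierCoeff (EuclideanSpace.complexify ∘ w) ![1, 0, -1]).ofLp 0 := by linear_combination -r10m
  have s01m : (mFourierCoeff (EuclideanSpace.complexify ∘ w) ![0, 1, -1]).ofLp 2 =
      (mFourierCoeff (EuclideanSpace.complexify ∘ w) ![0, 1, -1]).ofLp 1 := by linear_combination -r01m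
  have s1m0 : (mFourierCoeff (EuclideanSpace.complexify ∘ w) ![1, -1, 0]).ofLp 1 =
      (mFourierCoeff (EuclideanSpace.complexify ∘ w) ![1, -1, 0]).ofLp 0 := by linear_combination -r1m0
  simp only [s101, s011, s110, s10m, s01m, s1m0]
  simp only [Complex.mul_im, Complex.mul_re, Complex.add_im, Complex.add_re, Complex.neg_re, Complex.neg_im,
    Complex.conj_re, Complex.conj_im, Complex.I_re, Complex.I_im, Complex.ofReal_re, Complex.ofReal_im,
    Complex.zero_re, Complex.zero_im]
  ring


/-- The ABC frequencies `e₃, e₁, e₂` lie on the first shell. -/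
theorem abc_freqNormSq : ∀ m, Torus.freqNormSq ((![![0, 0, 1], ![1, 0, 0], ![0, 1, 0]] : Fin 3 → (Fin 3 → ℤ)) m) = 1 := by
  intro m
  fin_cases m <;> simp [Torus.freqNormSq, Fin.sum_univ_three]

/-- The ABC frequencies are in normal form. -/
theorem abc_normalForm : ∀ m m' : Fin 3, m ≠ m' →
    (![![0, 0, 1], ![1, 0, 0], ![0, 1, 0]] : Fin 3 → (Fin 3 → ℤ)) m ≠ (![![0, 0, 1], ![1, 0, 0], ![0, 1, 0]] : Fin 3 → (Fin 3 → ℤ)) m' ∧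
    (![![0, 0, 1], ![1, 0, 0], ![0, 1, 0]] : Fin 3 → (Fin 3 → ℤ)) m ≠ -(![![0, 0, 1], ![1, 0, 0], ![0, 1, 0]] : Fin 3 → (Fin 3 → ℤ)) m' := by
  decide

/-- The ABC amplitudes are transversal (`f` is divergence free). -/
theorem abc_transversal (A B C : ℝ) : ∀ m,
    ((fun j => ((((![![0, 0, 1], ![1, 0, 0], ![0, 1, 0]] : Fin 3 → (Fin 3 → ℤ)) m)) j : ℂ)) ⬝ᵥ
      (WithLp.ofLp (((![(A : ℂ) • (WithLp.toLp 2 ![-Complex.I, 1, 0] : EuclideanSpace ℂ (Fin 3)),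
                    (B : ℂ) • (WithLp.toLp 2 ![0, -Complex.I, 1] : EuclideanSpace ℂ (Fin 3)),
                    (C : ℂ) • (WithLp.toLp 2 ![1, 0, -Complex.I] : EuclideanSpace ℂ (Fin 3))] : Fin 3 → EuclideanSpace ℂ (Fin 3)) m)))) = 0 := by
  intro m
  fin_cases m <;>
    simp [dotProduct, Fin.sum_univ_three, Matrix.cons_val_zero, Matrix.cons_val_one, Matrix.cons_val_two,
      Matrix.head_cons, Matrix.tail_cons]

/-- Energy of the ABC force: `∫ ‖f‖² = A² + B² + C²`. -/
theorem abc_integral_norm_sq (A B C : ℝ) :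
    ∫ x, ‖(∑ mm, Torus.realTrigPoly {(![![0, 0, 1], ![1, 0, 0], ![0, 1, 0]] : Fin 3 → (Fin 3 → ℤ)) mm}
        (fun _ => (![(A : ℂ) • (WithLp.toLp 2 ![-Complex.I, 1, 0] : EuclideanSpace ℂ (Fin 3)),
                    (B : ℂ) • (WithLp.toLp 2 ![0, -Complex.I, 1] : EuclideanSpace ℂ (Fin 3)),
                    (C : ℂ) • (WithLp.toLp 2 ![1, 0, -Complex.I] : EuclideanSpace ℂ (Fin 3))] : Fin 3 → EuclideanSpace ℂ (Fin 3)) mm)) x‖ ^ 2 = A ^ 2 + B ^ 2 + C ^ 2 := by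
  rw [integral_norm_sq_modes_of_normalForm (fun m => ?_) abc_normalForm]
  · simp only [Fin.sum_univ_three, Matrix.cons_val_zero, Matrix.cons_val_one, Matrix.cons_val_two,
      Matrix.head_cons, Matrix.tail_cons, EuclideanSpace.norm_eq]
    simp [Complex.norm_I]
    rw [Real.sq_sqrt (by positivity), Real.sq_sqrt (by positivity), Real.sq_sqrt (by positivity)]
    ring
  · intro h0
    have := abc_freqNormSq m
    rw [h0, Torus.freqNormSq_zero] at this
    exact zero_ne_one this

/-- **The ABC forces have no ensemble ceiling** (`(A,B,C) ≠ 0`): the laminar ABC flow `f/(4π²ν)` is an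
exact steady state of `NS_ν(f)` for every `ν`, its Dirac mass a stationary statistical solution of
energy `(A²+B²+C²)/(16π⁴ν²)`. Pure-helical first-shell forces are dead for the crux; a witness built
from Beltrami waves must mix helicities or shells non-trivially (the frustrated `h₊ + T_a h₋`). -/
theorem not_ceiling_abc {A B C : ℝ} (h : A ≠ 0 ∨ B ≠ 0 ∨ C ≠ 0) :
    ¬ ∃ (E ν₀ : ℝ), 0 < ν₀ ∧ ∀ ν : ℝ, 0 < ν → ν < ν₀ → ∀ μ : Measure (Torus.energySpace (Fin 3)),
      Torus.IsStationaryStatisticalSolution ν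
        (∑ mm, Torus.realTrigPoly {(![![0, 0, 1], ![1, 0, 0], ![0, 1, 0]] : Fin 3 → (Fin 3 → ℤ)) mm}
        (fun _ => (![(A : ℂ) • (WithLp.toLp 2 ![-Complex.I, 1, 0] : EuclideanSpace ℂ (Fin 3)),
                    (B : ℂ) • (WithLp.toLp 2 ![0, -Complex.I, 1] : EuclideanSpace ℂ (Fin 3)),
                    (C : ℂ) • (WithLp.toLp 2 ![1, 0, -Complex.I] : EuclideanSpace ℂ (Fin 3))] : Fin 3 → EuclideanSpace ℂ (Fin 3)) mm)) μ →
        Integrable (fun v : (Torus.energySpace (Fin 3)) => ‖v‖ ^ 2) μ → Torus.ensembleEnergy μ ≤ E := by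
  refine not_ceiling_of_singleShell_eulerSteady abc_freqNormSq one_pos (abc_transversal A B C)
    (fun w hw hdw _ => abc_inertial_eq_zero A B C hw hdw) ?_
  rw [abc_integral_norm_sq]
  rcases h with hA | hB | hC
  · have := sq_pos_of_ne_zero hA; positivity
  · have := sq_pos_of_ne_zero hB; positivity
  · have := sq_pos_of_ne_zero hC; positivity

end Summit.AnomalousDissipation.AnomalousDissipation.Theorems.EnsembleCeiling.Negative
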